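import Mathlib
import HarnessLib

/-!
# The MHD safety factor on the magnetic axis, and the printed closed forms for the circular
# high-β (Solov'ev-profile) tokamak equilibrium

Topic `Literature/MathematicalPhysics/MHD` (namespace = path; sub-namespaces `SafetyFactor`,
`HighBetaCircular`).  Written for the venture ladder GRIDFUSION (rung F1): the Kruskal–Shafranov
condition `q_a > 1` and the on-axis Mercier condition `q₀ > 1` are CERTIFIABLE by exact arithmetic once
`q_a`, `q₀` are closed-form; this file records the printed closed forms with their derivable identities
PROVED.  THREE COLUMNS: everything here is MODELLED — §1 holds for any axisymmetric Grad–Shafranov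
equilibrium near its magnetic axis; §2 is the `ε`-expanded "circular high-β tokamak" with Solov'ev
profiles (Freidberg 2014 §6.5.2), not an exact equilibrium and not a device.

## Contents
* §1 `SafetyFactor.qAxis B_φ ψ_RR ψ_ZZ = B_φ/(ψ_RR ψ_ZZ)^{1/2}` (Freidberg2014 eq. (6.42)), from
  `q(ψ) = (F/2π)∮dl/(R²B_p)` (6.35) and the elliptic flux surfaces `ψ ≈ ½ψ_RR(R−R_a)² + ½ψ_ZZ(Z−Z_a)²`
  near the axis (6.36)–(6.41); PROVED second form `q₀ = (B_φ/(μ₀R_aJ_φ))(1+κ₀²)/κ₀` under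
  `ψ_RR/ψ_ZZ = κ₀²`, `ψ_RR + ψ_ZZ = −μ₀R_aJ_φ`; the CERTIFIABLE forms `q₀² = B_φ²/(ψ_RRψ_ZZ)`,
  `q₀ > 1 ↔ ψ_RRψ_ZZ < B_φ²`, `q₀ > c ↔ c²ψ_RRψ_ZZ < B_φ²` (PROVED).
* §2 `HighBetaCircular`: parameters `q_*` (kink safety factor, `1/q_* = μ₀R₀I/(2πa²B₀) = A/2B₀`,
  (6.102)) and `ν = β_t q_*²/ε` (6.104); `η = (1+3ν²)^{1/2}`; axis shift `Δ₀/a = ν/(1+η)` (6.108);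
  on-axis elongation `κ₀² = (1+3νδ₀)/(1+νδ₀) = 1 + 2ν²/(1+ν²+η)` (6.110, identity PROVED);
  `q₀ = q_*/((1+3νδ₀)(1+νδ₀))^{1/2} = q_*[3/(η(2+η))]^{1/2}` (6.113, identity PROVED);
  edge field `B_θ(a,θ) = (εB₀/q_*)(1+ν cos θ)` (6.116) and `q_a = (q_*/2π)∫₀^{2π}dθ/(1+ν cos θ)`
  with its printed value `q_*/(1−ν²)^{1/2}` (6.114) (the elementary integral is recorded as a
  definition pair; its evaluation is not re-proved here); the equilibrium-limit values at `ν = 1`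
  (6.115) PROVED; the printed inequalities `q₀ < q_*` (for `ν ≠ 0`) and `q_a ≥ q_*` PROVED.

## Sources, as printed (read on the page, 2026-08-26)
* J. P. Freidberg, *Ideal MHD*, CUP 2014 [Freidberg2014]: §6.3.5–§6.3.6 eqs. (6.32)–(6.42)
  (pp. 131–134); §6.5.2 eqs. (6.98)–(6.118) (pp. 154–165).

## Deliberately NOT here
The Solov'ev / Cerfon–Freidberg flux functions themselves (custody of the equilibrium typer; Freidberg2014
§6.5.2 eq. (6.101), §6.6.1 eq. (6.153)); the general contour integral `q(ψ)` (6.35) as a functional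
(needs the flux-surface geometry); the proof of `∫₀^{2π} dθ/(1+ν cos θ) = 2π/(1−ν²)^{1/2}`.
-/

noncomputable section

open Real

namespace Literature.MathematicalPhysics.MHD

/-! ## §1 The safety factor on the magnetic axis -/

namespace SafetyFactor

/-- The MHD safety factor ON THE MAGNETIC AXIS of an axisymmetric equilibrium:
`q₀ = B_φ / (ψ_RR ψ_ZZ)^{1/2}`, all quantities evaluated at the axis `(R_a, Z_a)` (where
`ψ_R = ψ_Z = 0`), obtained from `q(ψ) = (F/2π)∮ dl/(R²B_p)` on the elliptic surfaces
`ψ ≈ ½ψ_RR (R−R_a)² + ½ψ_ZZ (Z−Z_a)²`.  Inputs: the toroidal field `B_φ(R_a,Z_a)` and the two second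
derivatives of the flux function at the axis (same sign).  [cite: Freidberg2014, §6.3.6 eq. (6.42)] -/
def qAxis (Bφ ψRR ψZZ : ℝ) : ℝ := Bφ / Real.sqrt (ψRR * ψZZ)

/-- Second printed form of (6.42): with on-axis elongation `κ₀` (`ψ_RR = κ₀² ψ_ZZ`) and toroidal current
density `J_φ` on axis (`ψ_RR + ψ_ZZ = −μ₀ R_a J_φ`), `q₀ = (B_φ/(μ₀ R_a J_φ)) (1+κ₀²)/κ₀`.  PROVED for
`ψ_ZZ < 0` (flux decreasing away from the axis in the book's sign convention), `κ₀ > 0`.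
[cite: Freidberg2014, §6.3.6 eq. (6.42)] -/
theorem qAxis_eq_current_form {Bφ ψRR ψZZ κ₀ μ₀ Ra Jφ : ℝ} (hκ : 0 < κ₀) (hZZ : ψZZ < 0)
    (hell : ψRR = κ₀ ^ 2 * ψZZ) (hcur : ψRR + ψZZ = -(μ₀ * Ra * Jφ)) :
    qAxis Bφ ψRR ψZZ = Bφ / (μ₀ * Ra * Jφ) * ((1 + κ₀ ^ 2) / κ₀) := by
  unfold qAxis
  have hprod : ψRR * ψZZ = (κ₀ * ψZZ) ^ 2 := by rw [hell]; ring
  have hsqrt : Real.sqrt (ψRR * ψZZ) = -(κ₀ * ψZZ) := by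
    rw [hprod, Real.sqrt_sq_eq_abs, abs_of_neg (mul_neg_of_pos_of_neg hκ hZZ)]
  have hJ : μ₀ * Ra * Jφ = -(1 + κ₀ ^ 2) * ψZZ := by rw [← neg_neg (μ₀ * Ra * Jφ), ← hcur, hell]; ring
  rw [hsqrt, hJ]
  have h1 : (1 + κ₀ ^ 2) ≠ 0 := by positivity
  have h2 : ψZZ ≠ 0 := hZZ.ne
  have h3 : κ₀ ≠ 0 := hκ.ne'
  field_simp

/-- `q₀² = B_φ²/(ψ_RR ψ_ZZ)` when `ψ_RR ψ_ZZ ≥ 0` (the two second derivatives have the same sign at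
an elliptic point). [cite: Freidberg2014, §6.3.6 eq. (6.42)] -/
theorem qAxis_sq {Bφ ψRR ψZZ : ℝ} (h : 0 ≤ ψRR * ψZZ) :
    qAxis Bφ ψRR ψZZ ^ 2 = Bφ ^ 2 / (ψRR * ψZZ) := by
  unfold qAxis
  rw [div_pow, Real.sq_sqrt h]

/-- THE CERTIFIABLE FORM OF `q₀ > 1` (on-axis Kruskal–Shafranov / circular on-axis Mercier bound) for an
exact equilibrium whose axis Hessian is known exactly: for `B_φ > 0` and `ψ_RR ψ_ZZ > 0`,
`q₀ > 1 ↔ ψ_RR ψ_ZZ < B_φ²` — a polynomial inequality in the equilibrium data (rational for a polynomial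
Solov'ev flux function with rational coefficients).  [cite: Freidberg2014, §6.3.6 eq. (6.42)] -/
theorem one_lt_qAxis_iff {Bφ ψRR ψZZ : ℝ} (hB : 0 < Bφ) (h : 0 < ψRR * ψZZ) :
    1 < qAxis Bφ ψRR ψZZ ↔ ψRR * ψZZ < Bφ ^ 2 := by
  unfold qAxis
  have hs : 0 < Real.sqrt (ψRR * ψZZ) := Real.sqrt_pos.mpr h
  rw [one_lt_div hs, Real.sqrt_lt' hB]

/-- More generally `q₀ > c ↔ c² ψ_RR ψ_ZZ < B_φ²` for a threshold `c ≥ 0` (e.g. a rational lower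
bound to be certified with margin). [cite: Freidberg2014, §6.3.6 eq. (6.42)] -/
theorem lt_qAxis_iff {Bφ ψRR ψZZ c : ℝ} (hB : 0 < Bφ) (h : 0 < ψRR * ψZZ) (hc : 0 ≤ c) :
    c < qAxis Bφ ψRR ψZZ ↔ c ^ 2 * (ψRR * ψZZ) < Bφ ^ 2 := by
  unfold qAxis
  have hs : 0 < Real.sqrt (ψRR * ψZZ) := Real.sqrt_pos.mpr h
  rw [lt_div_iff₀ hs]
  constructor
  · intro hlt
    have h0 : 0 ≤ c * Real.sqrt (ψRR * ψZZ) := mul_nonneg hc hs.le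
    have h2 : (c * Real.sqrt (ψRR * ψZZ)) ^ 2 < Bφ ^ 2 := by
      exact pow_lt_pow_left₀ hlt h0 two_ne_zero
    rw [mul_pow, Real.sq_sqrt h.le] at h2
    exact h2
  · intro hlt
    have h0 : 0 ≤ c * Real.sqrt (ψRR * ψZZ) := mul_nonneg hc hs.le
    have h2 : (c * Real.sqrt (ψRR * ψZZ)) ^ 2 < Bφ ^ 2 := by
      rw [mul_pow, Real.sq_sqrt h.le]; exact hlt
    exact lt_of_pow_lt_pow_left₀ 2 hB.le h2

end SafetyFactor

/-! ## §2 The circular high-β tokamak with Solov'ev profiles: printed closed forms -/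

namespace HighBetaCircular

/-- `η = (1 + 3ν²)^{1/2}` (Freidberg's abbreviation in (6.113)), `ν = β_t q_*²/ε` the high-β parameter
(6.104). [cite: Freidberg2014, §6.5.2 eq. (6.113)] -/
def eta (ν : ℝ) : ℝ := Real.sqrt (1 + 3 * ν ^ 2)

/-- `η ≥ 1`. [cite: Freidberg2014, §6.5.2 eq. (6.113)] -/
lemma one_le_eta (ν : ℝ) : 1 ≤ eta ν := by
  unfold eta
  exact (Real.le_sqrt zero_le_one (by positivity)).mpr (by nlinarith [sq_nonneg ν])

/-- `η² = 1 + 3ν²`. [cite: Freidberg2014, §6.5.2 eq. (6.113)] -/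
lemma eta_sq (ν : ℝ) : eta ν ^ 2 = 1 + 3 * ν ^ 2 := by
  unfold eta; exact Real.sq_sqrt (by positivity)

/-- Shift of the magnetic axis relative to the centre of the circular plasma surface,
`δ₀ = Δ₀/a = ν / (1 + (1+3ν²)^{1/2})`. [cite: Freidberg2014, §6.5.2 eq. (6.108)] -/
def axisShift (ν : ℝ) : ℝ := ν / (1 + eta ν)

/-- On-axis elongation squared of the (elliptical) flux surfaces, `κ₀² = (1+3νδ₀)/(1+νδ₀)`.
[cite: Freidberg2014, §6.5.2 eq. (6.110)] -/
def kappa0Sq (ν : ℝ) : ℝ := (1 + 3 * ν * axisShift ν) / (1 + ν * axisShift ν)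

/-- Second printed form of (6.110), PROVED: `κ₀² = 1 + 2ν²/(1 + ν² + (1+3ν²)^{1/2})`.
[cite: Freidberg2014, §6.5.2 eq. (6.110)] -/
theorem kappa0Sq_eq (ν : ℝ) : kappa0Sq ν = 1 + 2 * ν ^ 2 / (1 + ν ^ 2 + eta ν) := by
  unfold kappa0Sq axisShift
  have hη := one_le_eta ν
  have h1 : 1 + eta ν ≠ 0 := by linarith
  have h2 : 1 + ν ^ 2 + eta ν ≠ 0 := by nlinarith [sq_nonneg ν]
  have h3 : 1 + ν * (ν / (1 + eta ν)) ≠ 0 := by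
    have : 0 ≤ ν * (ν / (1 + eta ν)) := by
      rw [← mul_div_assoc]; exact div_nonneg (by nlinarith [sq_nonneg ν]) (by linarith)
    linarith
  field_simp
  ring

/-- The safety factor ON AXIS of the circular high-β Solov'ev equilibrium,
`q₀ = q_* / ((1+3νδ₀)^{1/2}(1+νδ₀)^{1/2})`, from `q₀ = a²B₀/(ψ₀ₓₓψ₀ᵧᵧ)^{1/2}` (6.112) and the
near-axis expansion (6.107). [cite: Freidberg2014, §6.5.2 eq. (6.113)] -/
def qAxis (qstar ν : ℝ) : ℝ :=
  qstar / (Real.sqrt (1 + 3 * ν * axisShift ν) * Real.sqrt (1 + ν * axisShift ν))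

/-- The algebraic identity behind the second printed form of (6.113), PROVED:
`(1+3νδ₀)(1+νδ₀) = η(2+η)/3` with `η = (1+3ν²)^{1/2}`, `δ₀ = ν/(1+η)`.
[cite: Freidberg2014, §6.5.2 eq. (6.113)] -/
theorem axis_factor_eq (ν : ℝ) :
    (1 + 3 * ν * axisShift ν) * (1 + ν * axisShift ν) = eta ν * (2 + eta ν) / 3 := by
  unfold axisShift
  have hη := one_le_eta ν
  have hsq := eta_sq ν
  have h1 : 1 + eta ν ≠ 0 := by linarith
  field_simp
  nlinarith [hsq]

/-- Second printed form of (6.113), PROVED: `q₀ = q_* [3/(η(2+η))]^{1/2}`.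
[cite: Freidberg2014, §6.5.2 eq. (6.113)] -/
theorem qAxis_eq (qstar ν : ℝ) : qAxis qstar ν = qstar * Real.sqrt (3 / (eta ν * (2 + eta ν))) := by
  unfold qAxis
  have hη := one_le_eta ν
  have h0 : 0 ≤ ν * axisShift ν := by
    unfold axisShift; rw [← mul_div_assoc]
    exact div_nonneg (mul_self_nonneg ν) (by linarith)
  have ha : 0 ≤ 1 + 3 * ν * axisShift ν := by
    have : 3 * ν * axisShift ν = 3 * (ν * axisShift ν) := by ring
    rw [this]; linarith
  have hb : 0 ≤ 1 + ν * axisShift ν := by linarith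
  rw [← Real.sqrt_mul ha, axis_factor_eq ν]
  have hpos : 0 < eta ν * (2 + eta ν) := by nlinarith
  have hpos3 : 0 < eta ν * (2 + eta ν) / 3 := by positivity
  rw [div_eq_iff (Real.sqrt_pos.mpr hpos3).ne', mul_assoc, ← Real.sqrt_mul (by positivity)]
  rw [show 3 / (eta ν * (2 + eta ν)) * (eta ν * (2 + eta ν) / 3) = 1 from by field_simp]
  simp

/-- Printed remark, PROVED: for `ν ≠ 0` one has `q₀ < q_*` ("Since `η` is always greater than unity then
`q₀ < q_*`"), for `q_* > 0`. [cite: Freidberg2014, §6.5.2 eq. (6.113)] -/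
theorem qAxis_lt_qstar {qstar ν : ℝ} (hq : 0 < qstar) (hν : ν ≠ 0) : qAxis qstar ν < qstar := by
  rw [qAxis_eq]
  have hη := one_le_eta ν
  have hη1 : 1 < eta ν := by
    unfold eta
    have : 0 < ν ^ 2 := by positivity
    exact (Real.lt_sqrt zero_le_one).mpr (by nlinarith)
  have hlt : 3 / (eta ν * (2 + eta ν)) < 1 := by
    rw [div_lt_one (by nlinarith)]; nlinarith
  have hs : Real.sqrt (3 / (eta ν * (2 + eta ν))) < 1 := by
    rw [Real.sqrt_lt' one_pos]; simpa using hlt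
  calc qstar * Real.sqrt (3 / (eta ν * (2 + eta ν))) < qstar * 1 :=
        mul_lt_mul_of_pos_left hs hq
    _ = qstar := mul_one _

/-- The poloidal field on the plasma surface `r = a` of the circular high-β equilibrium,
`B_θ(a,θ) = (ε B₀/q_*)(1 + ν cos θ)`. [cite: Freidberg2014, §6.5.2 eq. (6.116)] -/
def edgePoloidalField (ε B₀ qstar ν θ : ℝ) : ℝ := ε * B₀ / qstar * (1 + ν * Real.cos θ)

/-- The safety factor AT THE PLASMA SURFACE as the printed integral,
`q_a ≈ (aB₀/2πR₀)∫₀^{2π} dθ/B_θ(a,θ) = (q_*/2π)∫₀^{2π} dθ/(1+ν cos θ)`.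
[cite: Freidberg2014, §6.5.2 eq. (6.114)] -/
def qEdgeIntegral (qstar ν : ℝ) : ℝ :=
  qstar / (2 * Real.pi) * ∫ θ in (0 : ℝ)..(2 * Real.pi), 1 / (1 + ν * Real.cos θ)

/-- The printed closed form of the edge safety factor, `q_a = q_*/(1−ν²)^{1/2}` (valid for `0 ≤ ν < 1`;
the equilibrium β-limit is `ν → 1`, `q_a → ∞` (6.115)).  This is the number the Kruskal–Shafranov
condition `q_a > 1` is tested on for this model.  (Equality with `qEdgeIntegral` is the elementary
integral `∫₀^{2π} dθ/(1+ν cos θ) = 2π/(1−ν²)^{1/2}`, not re-proved here.)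
[cite: Freidberg2014, §6.5.2 eq. (6.114)] -/
def qEdge (qstar ν : ℝ) : ℝ := qstar / Real.sqrt (1 - ν ^ 2)

/-- Printed remark, PROVED: `q_a ≥ q_*` for `0 ≤ ν < 1`, `q_* ≥ 0` ("This leads to the result that
`q_a > q_*`"). [cite: Freidberg2014, §6.5.2 eq. (6.114)] -/
theorem qstar_le_qEdge {qstar ν : ℝ} (hq : 0 ≤ qstar) (hν : ν ^ 2 < 1) : qstar ≤ qEdge qstar ν := by
  unfold qEdge
  have hs1 : Real.sqrt (1 - ν ^ 2) ≤ 1 := by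
    calc Real.sqrt (1 - ν ^ 2) ≤ Real.sqrt 1 := Real.sqrt_le_sqrt (by nlinarith [sq_nonneg ν])
      _ = 1 := Real.sqrt_one
  have hs0 : 0 < Real.sqrt (1 - ν ^ 2) := Real.sqrt_pos.mpr (by linarith)
  rw [le_div_iff₀ hs0]
  nlinarith

/-- KRUSKAL–SHAFRANOV ON THIS MODEL, the certifiable form: for `0 ≤ ν < 1` and `q_* > 0`,
`q_a > 1 ↔ 1 − ν² < q_*²` (squares of positive reals), so `q_a > 1` is decided by rational arithmetic
when `q_*`, `ν` are rational. [cite: Freidberg2014, §6.5.2 eq. (6.114)] -/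
theorem one_lt_qEdge_iff {qstar ν : ℝ} (hq : 0 < qstar) (hν : ν ^ 2 < 1) :
    1 < qEdge qstar ν ↔ 1 - ν ^ 2 < qstar ^ 2 := by
  unfold qEdge
  have hpos : 0 < 1 - ν ^ 2 := by linarith
  have hs0 : 0 < Real.sqrt (1 - ν ^ 2) := Real.sqrt_pos.mpr hpos
  rw [one_lt_div hs0, Real.sqrt_lt' hq]

/-- ON-AXIS `q₀ > 1` ON THIS MODEL, the certifiable form: for `q_* > 0`,
`q₀ > 1 ↔ η(2+η) < 3 q_*²` with `η = (1+3ν²)^{1/2}`. [cite: Freidberg2014, §6.5.2 eq. (6.113)] -/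
theorem one_lt_qAxis_iff {qstar ν : ℝ} (hq : 0 < qstar) :
    1 < qAxis qstar ν ↔ eta ν * (2 + eta ν) < 3 * qstar ^ 2 := by
  rw [qAxis_eq]
  have hη := one_le_eta ν
  have hpos : 0 < eta ν * (2 + eta ν) := by nlinarith
  set s := Real.sqrt (3 / (eta ν * (2 + eta ν))) with hs
  have hs0 : 0 ≤ s := Real.sqrt_nonneg _
  have hs2 : s ^ 2 = 3 / (eta ν * (2 + eta ν)) := Real.sq_sqrt (by positivity)
  have hs2' : s ^ 2 * (eta ν * (2 + eta ν)) = 3 := by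
    rw [hs2]; field_simp
  constructor
  · intro h
    have h2 : 1 < (qstar * s) ^ 2 := by nlinarith
    nlinarith [h2, hs2']
  · intro h
    by_contra hle
    rw [not_lt] at hle
    have hqs : 0 ≤ qstar * s := mul_nonneg hq.le hs0
    have h2 : (qstar * s) ^ 2 ≤ 1 := by nlinarith
    nlinarith [h2, hs2']

/-- The equilibrium-limit values at `ν = 1` (Freidberg2014 eq. (6.115)), PROVED from the closed forms:
`Δ₀/a = 1/3`. [cite: Freidberg2014, §6.5.2 eq. (6.115)] -/
theorem axisShift_one : axisShift 1 = 1 / 3 := by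
  unfold axisShift eta
  have : Real.sqrt (1 + 3 * (1:ℝ) ^ 2) = 2 := by
    rw [show (1:ℝ) + 3 * 1 ^ 2 = 2 ^ 2 by norm_num, Real.sqrt_sq (by norm_num)]
  rw [this]; norm_num

/-- `κ₀² = 3/2` at `ν = 1`, i.e. `κ₀ = (3/2)^{1/2}`. [cite: Freidberg2014, §6.5.2 eq. (6.115)] -/
theorem kappa0Sq_one : kappa0Sq 1 = 3 / 2 := by
  unfold kappa0Sq
  rw [axisShift_one]; norm_num

/-- `q₀ = (3/8)^{1/2} q_*` at `ν = 1`. [cite: Freidberg2014, §6.5.2 eq. (6.115)] -/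
theorem qAxis_one (qstar : ℝ) : qAxis qstar 1 = qstar * Real.sqrt (3 / 8) := by
  rw [qAxis_eq]
  unfold eta
  have : Real.sqrt (1 + 3 * (1:ℝ) ^ 2) = 2 := by
    rw [show (1:ℝ) + 3 * 1 ^ 2 = 2 ^ 2 by norm_num, Real.sqrt_sq (by norm_num)]
  rw [this]; norm_num

end HighBetaCircular

end Literature.MathematicalPhysics.MHD

end
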